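import Literature.Probability.LatticeModels.KCSpinorLaplacian
import Literature.Probability.LatticeModels.HoleFreePotential
import Literature.Probability.LatticeModels.BoundaryPoleGreenBounds
import HarnessLib

/-!
# The primitive `H^{(a)}` of the square of a seam section near the source (CHI Remark 3.8 / 3.9)

Topic `Literature/Probability/LatticeModels`. Chelkak–Hongler–Izyurov 2015, §3.3.1 (3.17) and
Remark 3.8: `H^{(a)}_δ := Re ∫ (F_{[Ω_δ,a]} - F_{[ℂ_δ,a]})²` is well defined near `a`, subharmonic on
faces and superharmonic on vertices INCLUDING `a` and `a + δ` (because the difference is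
s-holomorphic at the source corner too, Lemma 3.5), hence (maximum principle) bounded inside a disc
around `a` by its values on the boundary annulus. In the tree, for an arbitrary bond function `F`
having, on a set of corners `K`, the table of a SEAM SECTION about the source plaquette `p₀`
(`IsSeamSection F p₀ K`: s-holomorphic off the east seam of lower corners from `v₀ = p₀ + e₀ + e₁`,
opposite projections on it, and BOTH at the source corner `(v₀, SW)` — the table established for the
gauged difference in `KCGaugedDifference.lean`):

* `seamSign p₀ q`, its parities around sites (`seamSign_site_parity`, off `v₀`) and plaquettes
  (`seamSign_face_parity`);
* `IsSeamSection.latticeLaplacian_white_nonpos` / `…_black_nonneg` for any primitive pair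
  (`KCSpinorLaplacian.lean`), at EVERY site / plaquette whose eight corners lie in `K` — no
  exception at `v₀` or `p₀`; `IsSeamSection.isCornerClosedOn`;
* **`IsSeamSection.exists_primitive_sqBox`**: on a square box of plaquettes `sqBox c R` whose corners
  lie in `K` there is a primitive pair `(Hw, Hb)` of `F` (`exists_potential_of_holeFree`,
  `holeFree_sqBox`), superharmonic / subharmonic on `sqBox c (R - 1)`;
* **`abs_le_of_ring`**: for such a pair, `|Hw|, |Hb| ≤ M` on the whole box as soon as this holds on
  the ring `sqBox c R ∖ sqBox c (R - 1)` (maximum principle both ways and `Hw ≤ Hb` across a corner).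

Everything is proved; no named fact.

## References

* D. Chelkak, C. Hongler, K. Izyurov, Ann. of Math. 181 (2015), §3.3.1, Remark 3.8, Remark 3.9
  [ChelkakHonglerIzyurovAnnals2015].
* S. Smirnov, Ann. of Math. 172 (2010), Lemma 3.6, Lemma 3.8 [Smirnov2010].
-/

noncomputable section

namespace Literature.Probability.LatticeModels

open Complex Finset WeakBeurling

/-! ### The sign pattern of the seam -/

/-- **The sign pattern of the source seam**: `-1` at the lower corners `(y, SW)` with `y = v₀ + (I, 0)`,
`I ≥ 1`, and `(y, SE)` with `I ≥ 0`; `+1` elsewhere (in particular at the source corner itself). [cite: ChelkakHonglerIzyurovAnnals2015, §3.2 and Remark 3.9] -/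
def seamSign (p₀ : Site 2) (q : Site 2 × Fin 4) : ℝ :=
  if (q.2 = 2 ∧ srcJ p₀ q.1 = 0 ∧ 1 ≤ srcI p₀ q.1) ∨ (q.2 = 3 ∧ srcJ p₀ q.1 = 0 ∧ 0 ≤ srcI p₀ q.1) then -1 else 1

/-- `seamSign = ±1`. [folklore] -/
theorem seamSign_cases (p₀ : Site 2) (q : Site 2 × Fin 4) : seamSign p₀ q = 1 ∨ seamSign p₀ q = -1 := by
  unfold seamSign; split_ifs
  · exact Or.inr rfl
  · exact Or.inl rfl

/-- Upper corners carry `+1`. [folklore] -/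
theorem seamSign_zero (p₀ y : Site 2) : seamSign p₀ (y, 0) = 1 := by
  unfold seamSign; rw [if_neg]; simp

/-- Upper corners carry `+1`. [folklore] -/
theorem seamSign_one (p₀ y : Site 2) : seamSign p₀ (y, 1) = 1 := by
  unfold seamSign; rw [if_neg]; simp

/-- The `SW` corners. [folklore] -/
theorem seamSign_two (p₀ y : Site 2) : seamSign p₀ (y, 2) = if srcJ p₀ y = 0 ∧ 1 ≤ srcI p₀ y then -1 else 1 := by
  unfold seamSign
  by_cases h : srcJ p₀ y = 0 ∧ 1 ≤ srcI p₀ y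
  · rw [if_pos (Or.inl ⟨rfl, h⟩), if_pos h]
  · rw [if_neg, if_neg h]; simpa using h

/-- The `SE` corners. [folklore] -/
theorem seamSign_three (p₀ y : Site 2) : seamSign p₀ (y, 3) = if srcJ p₀ y = 0 ∧ 0 ≤ srcI p₀ y then -1 else 1 := by
  unfold seamSign
  by_cases h : srcJ p₀ y = 0 ∧ 0 ≤ srcI p₀ y
  · rw [if_pos (Or.inr ⟨rfl, h⟩), if_pos h]
  · rw [if_neg, if_neg h]; simpa using h

/-- Offsets of the source site `v₀`: `srcI = srcJ = 0` iff `y = v₀`. [folklore] -/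
theorem srcI_srcJ_eq_zero_iff (p₀ y : Site 2) : srcI p₀ y = 0 ∧ srcJ p₀ y = 0 ↔ y = p₀ + cornerUnit 0 + cornerUnit 1 := by
  simp only [srcI, srcJ]
  constructor
  · rintro ⟨h0, h1⟩
    ext i; fin_cases i <;> simp [cornerUnit] <;> omega
  · rintro rfl
    simp [cornerUnit]

/-- **Even parity around a site off `v₀`.** [folklore] -/
theorem seamSign_site_parity (p₀ : Site 2) {u : Site 2} (hu : u ≠ p₀ + cornerUnit 0 + cornerUnit 1) :
    seamSign p₀ (u, 0) * seamSign p₀ (u, 1) * seamSign p₀ (u, 2) * seamSign p₀ (u, 3) = 1 := by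
  rw [seamSign_zero, seamSign_one, seamSign_two, seamSign_three, one_mul, one_mul]
  have hne : ¬(srcI p₀ u = 0 ∧ srcJ p₀ u = 0) := fun h => hu ((srcI_srcJ_eq_zero_iff p₀ u).1 h)
  by_cases h2 : srcJ p₀ u = 0 ∧ 1 ≤ srcI p₀ u
  · rw [if_pos h2, if_pos ⟨h2.1, by omega⟩]; norm_num
  · rw [if_neg h2, if_neg (fun h3 => ?_)]
    · norm_num
    · rcases eq_or_lt_of_le h3.2 with h | h
      · exact hne ⟨h.symm, h3.1⟩
      · exact h2 ⟨h3.1, by omega⟩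

/-- Offsets of the corners of a plaquette: the `SW` corner of `f + e₀ + e₁` and the `SE` corner of
`f + e₁` are on the seam together. [folklore] -/
theorem src_face_corners (p₀ f : Site 2) :
    srcJ p₀ (f + cornerOff 2) = srcJ p₀ (f + cornerOff 3) ∧ srcI p₀ (f + cornerOff 2) = srcI p₀ (f + cornerOff 3) + 1 := by
  simp [srcI, srcJ, cornerOff]; ring

/-- **Even parity around every plaquette.** [folklore] -/
theorem seamSign_face_parity (p₀ f : Site 2) :
    seamSign p₀ (f + cornerOff 0, 0) * seamSign p₀ (f + cornerOff 1, 1) * seamSign p₀ (f + cornerOff 2, 2) *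
      seamSign p₀ (f + cornerOff 3, 3) = 1 := by
  obtain ⟨hJ, hI⟩ := src_face_corners p₀ f
  rw [seamSign_zero, seamSign_one, seamSign_two, seamSign_three, one_mul, one_mul, hJ, hI]
  by_cases h : srcJ p₀ (f + cornerOff 3) = 0 ∧ 0 ≤ srcI p₀ (f + cornerOff 3)
  · rw [if_pos ⟨h.1, by omega⟩, if_pos h]; norm_num
  · rw [if_neg (fun h' => h ⟨h'.1, by omega⟩), if_neg h]; norm_num

/-! ### Seam sections -/

/-- **A seam section about the source plaquette `p₀` on the corner set `K`**: compatible with the seam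
sign pattern on `K`, and ALSO anti at the source corner (both projections vanish there). [cite: ChelkakHonglerIzyurovAnnals2015, Lemma 3.5 and Remark 3.9] -/
structure IsSeamSection (F : MedialVertex → ℂ) (p₀ : Site 2) (K : Set (Site 2 × Fin 4)) : Prop where
  table : ∀ q ∈ K, CompatAt F q (seamSign p₀ q)
  source : CompatAt F (p₀ + cornerUnit 0 + cornerUnit 1, 2) (-1)

namespace IsSeamSection

variable {F : MedialVertex → ℂ} {p₀ : Site 2} {K : Set (Site 2 × Fin 4)}

/-- **`Δ Hw ≤ 0` at every site whose eight corners lie in `K`** — including `v₀`. [cite: ChelkakHonglerIzyurovAnnals2015, Remark 3.8 and Remark 3.9] -/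
theorem latticeLaplacian_white_nonpos (hF : IsSeamSection F p₀ K) {Hw Hb : Site 2 → ℝ} {Q : Set (Site 2 × Fin 4)}
    (hP : IsPrimitivePair F Hw Hb Q) (u : Site 2) (hQ : ∀ k : Fin 4, (u, k) ∈ Q ∧ (u + cornerUnit k, k + 1) ∈ Q)
    (hK : ∀ k : Fin 4, (u, k) ∈ K ∧ (u + cornerUnit k, k + 1) ∈ K) :
    latticeLaplacian Hw u ≤ 0 := by
  have hout : ∀ k, CompatAt F (u + cornerUnit k, k + 1) (seamSign p₀ (u + cornerUnit k, k + 1)) :=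
    fun k => hF.table _ (hK k).2
  by_cases hu : u = p₀ + cornerUnit 0 + cornerUnit 1
  · -- at the source site: signs `(1, 1, -1, -1)`
    have h3 : seamSign p₀ (u, 3) = -1 := by
      rw [seamSign_three, if_pos]; rw [hu]; simp [srcI, srcJ, cornerUnit]
    refine hP.latticeLaplacian_white_nonpos_of_compat u hQ (s := ![1, 1, -1, -1]) (fun k => ?_) hout (by simp)
    fin_cases k
    · simpa [seamSign_zero] using hF.table _ (hK 0).1
    · simpa [seamSign_one] using hF.table _ (hK 1).1
    · simpa [hu] using hF.source
    · simpa [h3] using hF.table _ (hK 3).1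
  · exact hP.latticeLaplacian_white_nonpos_of_compat u hQ (fun k => hF.table _ (hK k).1) hout
      (seamSign_site_parity p₀ hu)

/-- **`Δ Hb ≥ 0` at every plaquette whose eight corners lie in `K`** — including `p₀`. [cite: ChelkakHonglerIzyurovAnnals2015, Remark 3.8 and Remark 3.9] -/
theorem latticeLaplacian_black_nonneg (hF : IsSeamSection F p₀ K) {Hw Hb : Site 2 → ℝ} {Q : Set (Site 2 × Fin 4)}
    (hP : IsPrimitivePair F Hw Hb Q) (f : Site 2) (hQ : ∀ j : Fin 4, (f + cornerOff j, j) ∈ Q ∧ (f + cornerOff j, j + 3) ∈ Q)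
    (hK : ∀ j : Fin 4, (f + cornerOff j, j) ∈ K ∧ (f + cornerOff j, j + 3) ∈ K) :
    0 ≤ latticeLaplacian Hb f :=
  hP.latticeLaplacian_black_nonneg_of_compat f hQ (fun j => hF.table _ (hK j).1) (fun j => hF.table _ (hK j).2)
    (seamSign_face_parity p₀ f)

/-- **The flux form of a seam section is closed** on any face set whose arriving corners lie in `K`. [cite: Smirnov2010, proof of Lemma 3.6] -/
theorem isCornerClosedOn (hF : IsSeamSection F p₀ K) (Φ : Set (Site 2))
    (hK : ∀ (u : Site 2) (k : Fin 4), faceAt u k ∈ Φ → faceAt u (k + 3) ∈ Φ → (u, k + 3) ∈ K ∧ (u + cornerUnit k, k + 1) ∈ K) :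
    IsCornerClosedOn (cornerFlux F) Φ :=
  isCornerClosedOn_cornerFlux_of_compat F Φ fun u k h₁ h₂ =>
    ⟨⟨_, hF.table _ (hK u k h₁ h₂).1⟩, ⟨_, hF.table _ (hK u k h₁ h₂).2⟩⟩

end IsSeamSection

/-! ### Square boxes: membership bookkeeping -/

/-- A site within `1` of a site of `sqBox c n` (coordinatewise) lies in `sqBox c (n + 1)`. [folklore] -/
theorem mem_sqBox_of_near {c y z : Site 2} {n : ℤ} (h : y ∈ sqBox c n) (hz : ∀ i, |z i - y i| ≤ 1) : z ∈ sqBox c (n + 1) := by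
  rw [mem_sqBox] at h ⊢
  have key : ∀ i : Fin 2, |y i - c i| ≤ n → |z i - c i| ≤ n + 1 := fun i hi =>
    calc |z i - c i| = |(z i - y i) + (y i - c i)| := by ring_nf
      _ ≤ |z i - y i| + |y i - c i| := abs_add_le _ _
      _ ≤ n + 1 := by linarith [hz i]
  exact ⟨key 0 h.1, key 1 h.2⟩

/-- Coordinates of the unit vectors are at most `1` in absolute value (the Literature home of the
Summits-side helper `abs_cornerUnit_apply_le` of CardyFormulaZ2/EdgeCoherence). [folklore] -/
theorem abs_cornerUnit_apply_le_one (k : Fin 4) (i : Fin 2) : |cornerUnit k i| ≤ 1 := by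
  fin_cases k <;> fin_cases i <;> simp [cornerUnit]

/-- Bookkeeping (`add_cornerUnit_mem_sqBox`). [folklore] -/
theorem add_cornerUnit_mem_sqBox {c y : Site 2} {n : ℤ} (h : y ∈ sqBox c n) (k : Fin 4) : y + cornerUnit k ∈ sqBox c (n + 1) :=
  mem_sqBox_of_near h fun i => by simpa using abs_cornerUnit_apply_le_one k i

/-- Bookkeeping (`add_cornerOff_mem_sqBox`). [folklore] -/
theorem add_cornerOff_mem_sqBox {c y : Site 2} {n : ℤ} (h : y ∈ sqBox c n) (k : Fin 4) : y + cornerOff k ∈ sqBox c (n + 1) :=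
  mem_sqBox_of_near h fun i => by
    have : |cornerOff k i| ≤ 1 := by fin_cases k <;> fin_cases i <;> simp [cornerOff]
    simpa using this

/-- Bookkeeping (`faceAt_mem_sqBox`). [folklore] -/
theorem faceAt_mem_sqBox {c y : Site 2} {n : ℤ} (h : y ∈ sqBox c n) (k : Fin 4) : faceAt y k ∈ sqBox c (n + 1) :=
  mem_sqBox_of_near h fun i => by
    have : |cornerOff k i| ≤ 1 := by fin_cases k <;> fin_cases i <;> simp [cornerOff]
    simpa [faceAt, abs_neg] using this

/-- Bookkeeping (`mem_sqBox_of_faceAt_mem`). [folklore] -/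
theorem mem_sqBox_of_faceAt_mem {c y : Site 2} {n : ℤ} {k : Fin 4} (h : faceAt y k ∈ sqBox c n) : y ∈ sqBox c (n + 1) :=
  mem_sqBox_of_near h fun i => by
    have : |cornerOff k i| ≤ 1 := by fin_cases k <;> fin_cases i <;> simp [cornerOff]
    simpa [faceAt] using this

/-- The outer boundary of a box sits in the next box. [folklore] -/
theorem latticeOuterBoundary_sqBox_subset (c : Site 2) (n : ℤ) :
    latticeOuterBoundary (sqBox c n) ⊆ sqBox c (n + 1) \ sqBox c n := by
  rintro w ⟨hw, v, hv, k, rfl⟩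
  exact ⟨add_cornerUnit_mem_sqBox hv k, hw⟩

/-! ### The primitive on a box and its bound by the ring values -/

namespace IsSeamSection

variable {F : MedialVertex → ℂ} {p₀ : Site 2} {K : Set (Site 2 × Fin 4)}

/-- **`H^{(a)}` on a box** (CHI (3.17), Remark 3.8): a seam section whose corners at the sites of
`sqBox c (R + 1)` lie in `K` has a primitive pair on the plaquettes of `sqBox c R`, with
`Δ Hw ≤ 0` and `Δ Hb ≥ 0` on `sqBox c (R - 1)` (sites, resp. plaquettes) — no exception at the
source. [cite: ChelkakHonglerIzyurovAnnals2015, §3.3.1 (3.17) and Remark 3.8] -/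
theorem exists_primitive_sqBox (hF : IsSeamSection F p₀ K) (c : Site 2) (R : ℤ)
    (hK : ∀ y ∈ sqBox c (R + 1), ∀ k : Fin 4, (y, k) ∈ K) :
    ∃ Hw Hb : Site 2 → ℝ, IsPrimitivePair F Hw Hb (faceSetCorners (sqBox c R)) ∧
      IsLatticeSuperharmonicOn Hw (sqBox c (R - 1)) ∧ IsLatticeSubharmonicOn Hb (sqBox c (R - 1)) := by
  classical
  set P : Finset (Site 2) := (sqBox_finite c R).toFinset with hP
  have hPc : (↑P : Set (Site 2)) = sqBox c R := by rw [hP, Set.Finite.coe_toFinset]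
  have hclosed : IsCornerClosedOn (cornerFlux F) ↑P := by
    rw [hPc]
    refine hF.isCornerClosedOn _ fun u k h₁ _ => ⟨hK _ (mem_sqBox_of_faceAt_mem h₁) _, hK _ ?_ _⟩
    have : faceAt (u + cornerUnit k) (k + 1) = faceAt u k := faceAt_add_unit_succ u k
    exact mem_sqBox_of_faceAt_mem (this ▸ h₁)
  obtain ⟨Hw, Hb, hpot⟩ := exists_potential_of_holeFree (cornerFlux F) P (hPc ▸ holeFree_sqBox c R) hclosed
  rw [hPc] at hpot
  have hPP : IsPrimitivePair F Hw Hb (faceSetCorners (sqBox c R)) := fun q hq => hpot q hq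
  refine ⟨Hw, Hb, hPP, fun u hu => ?_, fun f hf => ?_⟩
  · -- sites of `sqBox c (R - 1)`: all corners of `u` and of its neighbours code faces of the box
    have hu' : u ∈ sqBox c R := by simpa using add_cornerUnit_mem_sqBox hu 0 |> fun h => sqBox_mono c (by linarith) (hu)
    have hfaces : ∀ k : Fin 4, faceAt u k ∈ sqBox c R := fun k => by
      have := faceAt_mem_sqBox hu k; rwa [sub_add_cancel] at this
    refine hF.latticeLaplacian_white_nonpos hPP u (fun k => ⟨?_, ?_⟩) (fun k => ⟨hK _ (sqBox_mono c (by linarith) hu') _, hK _ ?_ _⟩)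
    · exact hfaces k
    · show faceAt (u + cornerUnit k) (k + 1) ∈ sqBox c R
      rw [faceAt_add_unit_succ]; exact hfaces k
    · have := add_cornerUnit_mem_sqBox hu k
      exact sqBox_mono c (by linarith) (by simpa using add_cornerUnit_mem_sqBox this 0 |> fun _ => this)
  · -- plaquettes of `sqBox c (R - 1)`
    have hf' : f ∈ sqBox c R := sqBox_mono c (by linarith) hf
    refine hF.latticeLaplacian_black_nonneg hPP f (fun j => ⟨?_, ?_⟩) (fun j => ⟨hK _ ?_ _, hK _ ?_ _⟩)
    · show cFace (f + cornerOff j, j) ∈ sqBox c R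
      rw [cFace_face_corner]; exact hf'
    · show faceAt (f + cornerOff j) (j + 3) ∈ sqBox c R
      rw [faceAt_face_corner_add_three]
      have := add_cornerUnit_mem_sqBox hf (j + 3); rwa [sub_add_cancel] at this
    · exact sqBox_mono c (by linarith) (add_cornerOff_mem_sqBox hf j)
    · exact sqBox_mono c (by linarith) (add_cornerOff_mem_sqBox hf j)

/-- **The bound by the ring values** (maximum principle, CHI Remark 3.8 ⇒ property (4)): for a
primitive pair on the plaquettes of `sqBox c R`, superharmonic / subharmonic on `sqBox c (R - 1)`,
bounds `|Hw|, |Hb| ≤ M` on the ring `sqBox c R ∖ sqBox c (R - 1)` propagate to the whole box. [cite: ChelkakHonglerIzyurovAnnals2015, Remark 3.8] -/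
theorem abs_le_of_ring {Hw Hb : Site 2 → ℝ} {c : Site 2} {R : ℤ}
    (hPP : IsPrimitivePair F Hw Hb (faceSetCorners (sqBox c R)))
    (hsup : IsLatticeSuperharmonicOn Hw (sqBox c (R - 1))) (hsub : IsLatticeSubharmonicOn Hb (sqBox c (R - 1))) {M : ℝ}
    (hwM : ∀ y ∈ sqBox c R, y ∉ sqBox c (R - 1) → |Hw y| ≤ M) (hbM' : ∀ y ∈ sqBox c R, y ∉ sqBox c (R - 1) → |Hb y| ≤ M) :
    ∀ y ∈ sqBox c R, |Hw y| ≤ M ∧ |Hb y| ≤ M := by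
  have hfin : (sqBox c (R - 1)).Finite := sqBox_finite c (R - 1)
  have hbdry : ∀ w ∈ latticeOuterBoundary (sqBox c (R - 1)), w ∈ sqBox c R ∧ w ∉ sqBox c (R - 1) := fun w hw => by
    have := latticeOuterBoundary_sqBox_subset c (R - 1) hw
    rw [sub_add_cancel] at this
    exact this
  -- `Hb ≤ M` and `-M ≤ Hw` everywhere on the box
  have hbM : ∀ y ∈ sqBox c R, Hb y ≤ M := by
    intro y hy
    by_cases hy' : y ∈ sqBox c (R - 1)
    · exact hsub.le_of_forall_boundary_le hfin (fun w hw => (abs_le.1 (hbM' w (hbdry w hw).1 (hbdry w hw).2)).2) y hy'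
    · exact (abs_le.1 (hbM' y hy hy')).2
  have hwlow : ∀ y ∈ sqBox c R, -M ≤ Hw y := by
    intro y hy
    by_cases hy' : y ∈ sqBox c (R - 1)
    · exact hsup.ge_of_forall_boundary_ge hfin (fun w hw => (abs_le.1 (hwM w (hbdry w hw).1 (hbdry w hw).2)).1) y hy'
    · exact (abs_le.1 (hwM y hy hy')).1
  -- across the corner `(y, 0)`: `Hw y ≤ Hb y`
  have hcorner : ∀ y ∈ sqBox c R, Hw y ≤ Hb y := by
    intro y hy
    have hq : ((y, (0 : Fin 4)) : Site 2 × Fin 4) ∈ faceSetCorners (sqBox c R) := by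
      show faceAt y 0 ∈ sqBox c R
      simpa [faceAt, cornerOff] using hy
    have e := hPP _ hq
    have hpos := cornerFlux_nonneg F (y, 0)
    simp only [cFace] at e
    have : faceAt y 0 = y := by simp [faceAt, cornerOff]
    rw [this] at e
    linarith
  intro y hy
  have h1 := hbM y hy
  have h2 := hwlow y hy
  have h3 := hcorner y hy
  exact ⟨abs_le.2 ⟨h2, h3.trans h1⟩, abs_le.2 ⟨h2.trans h3, h1⟩⟩

end IsSeamSection

end Literature.Probability.LatticeModels
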